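import Summits.Ventures.Crystal3D.Theorems.StickyWulffConstantGenericWallFloorStackLedgerLocalCountSep
import HarnessLib

/-!
# The WALKER-FAMILY LEDGER: injective families of certified walkers pay, `#T₁ + #T₂ ≤ Σ_PAY (12 − deg)`
# (crux `GenericWallFloor`, stmt-Ventures-19480, line `WallLedgerG`; plate-agnostic core of `…StackLedgerOffReach`)

HONEST FRAMING. Part of the venture `Summits/Ventures/Crystal3D` (cell `crystal3d-full`), helper `--supports` the
crux `GenericWallFloor` (stmt-Ventures-19480) of `route-Ventures-StickyWulffConstant`, registered line `WallLedgerG`,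
open stub `stub_twoSlabAdhesion`.  Rung credit only; F-C1 not moved; NOT the stub.

`twoSlabAdhesion_stackLedger_offReach` mixes three things: (i) the fcc clamped samples (fullness, tops along a steep
slot, the flux count, slab sealing), (ii) the walk (`stackWalk_end`, validity, reach sets), (iii) the COUNT — per payer
ball `deg y + #(end states at y) ≤ 12` (`card_contacts_add_endStates_le_twelve_sep`) summed over the payers.  Lane T
(decision (xxxiv‴)) wants (ii)+(iii) with BARLOW plates in (i).  This file isolates the count for ABSTRACT families:

* **`walkerFamilies_card_le_payers`** — two finite families of START states (index types `ι₁`, `ι₂`; verticals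
  `z₁`, `z₂`; bottom entries `b₁`, `b₂`), each member valid (`WalkInv`, `StackWF`, bottom `bᵢ`, strong certificate at
  the start) with enough fuel `N`; the maps `t ↦ walkRun N (stᵢ t)` injective on each family (e.g. by
  `walkRun_injOn_of_exit` of `…CapStart`); every end ball in the finite set `PAY`; and the two families' end balls
  POSITIONALLY DISJOINT (no ball is an end ball of both — off the registry set this is `reachSet_disjoint_iff`).  Then
  `#T₁ + #T₂ ≤ Σ_{y ∈ PAY} (12 − deg y)`.  Inputs BY NAME as in the whole lane: `ExactOnly` (C12-55),
  `DoubleStarCoaxialAt` (all frame pairs) and `CapPairCoaxial` (= `StarPairFar`).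
* `walkerFamily_card_le_payers` — the one-family case.

Nothing about plates is read: the start states may come from `walkInv_start` (fcc-full balls) or from
`walkInv_capStart` / `walkInv_capStart₂` (half-full / twin-dozen balls of a Barlow plate); `PAY`-membership of the ends
(sealing) and the size of the families (flux) are the caller's.

WHAT THIS IS NOT: not the stub; no sealing, no flux count, no inner-face bookkeeping; F-C1 not moved.
-/

noncomputable section

namespace Summit.Ventures.Crystal3D.Theorems

open Finset
open scoped InnerProductSpace

variable {X : Finset (EuclideanSpace ℝ (Fin 3))}

/-- Any bottom entry differs from SOME entry (a dummy second bottom for the one-sided use of the count lemma). -/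
theorem exists_walkEntry_ne (b : WalkEntry) : ∃ b' : WalkEntry, b' ≠ b := by
  refine ⟨⟨b.frame, b.dir + EuclideanSpace.single (0 : Fin 3) (1 : ℝ), b.nrm⟩, fun h => ?_⟩
  have h1 := congrArg WalkEntry.dir h
  simp only at h1
  have h2 : EuclideanSpace.single (0 : Fin 3) (1 : ℝ) = 0 := by
    have := congrArg (fun x => x - b.dir) h1
    simp at this
  have h3 := congrArg (fun v : EuclideanSpace ℝ (Fin 3) => v 0) h2
  simp at h3

open scoped Classical in
/-- **The walker-family ledger (two families, positionally disjoint ends).**  See the module docstring.  `deg y` is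
`#(X.filter (dist y · = 1))`; the end of `t` is `walkRun X zᵢ N (stᵢ t)`. -/
theorem walkerFamilies_card_le_payers (hX : ∀ p ∈ X, ∀ q ∈ X, p ≠ q → 1 ≤ dist p q)
    {s₀ : EuclideanSpace ℝ (Fin 3)} (hs₀ : s₀ ∈ fccSlots)
    (hcert : ExactOnly 0 (fccSlots.filter fun w => 0 < ⟪w, s₀⟫_ℝ))
    (hDS : ∀ F₁ F₂ : EuclideanSpace ℝ (Fin 3) ≃ₗᵢ[ℝ] EuclideanSpace ℝ (Fin 3), DoubleStarCoaxialAt F₁ F₂)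
    (hCP : CapPairCoaxial)
    {z₁ z₂ : EuclideanSpace ℝ (Fin 3)} (hz₁ : ‖z₁‖ = 1) (hz₂ : ‖z₂‖ = 1) {H₁ H₂ : ℝ}
    (hH₁ : ∀ q ∈ X, ⟪q, z₁⟫_ℝ ≤ H₁) (hH₂ : ∀ q ∈ X, ⟪q, z₂⟫_ℝ ≤ H₂)
    {ι₁ ι₂ : Type*} (T₁ : Finset ι₁) (T₂ : Finset ι₂)
    (st₁ : ι₁ → EuclideanSpace ℝ (Fin 3) × List WalkEntry) (st₂ : ι₂ → EuclideanSpace ℝ (Fin 3) × List WalkEntry)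
    {b₁ b₂ : WalkEntry} (N : ℕ)
    (hst₁ : ∀ t ∈ T₁, WalkInv X z₁ (st₁ t) ∧ StackWF z₁ (st₁ t).2 ∧ (st₁ t).2.getLast? = some b₁ ∧
      (∃ e rest, (st₁ t).2 = e :: rest ∧ WalkCertified12 X (st₁ t).1 e) ∧ 8 * (H₁ - ⟪(st₁ t).1, z₁⟫_ℝ) < 3 * N)
    (hst₂ : ∀ t ∈ T₂, WalkInv X z₂ (st₂ t) ∧ StackWF z₂ (st₂ t).2 ∧ (st₂ t).2.getLast? = some b₂ ∧
      (∃ e rest, (st₂ t).2 = e :: rest ∧ WalkCertified12 X (st₂ t).1 e) ∧ 8 * (H₂ - ⟪(st₂ t).1, z₂⟫_ℝ) < 3 * N)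
    (hinj₁ : ∀ t ∈ T₁, ∀ t' ∈ T₁, walkRun X z₁ N (st₁ t) = walkRun X z₁ N (st₁ t') → t = t')
    (hinj₂ : ∀ t ∈ T₂, ∀ t' ∈ T₂, walkRun X z₂ N (st₂ t) = walkRun X z₂ N (st₂ t') → t = t')
    (PAY : Finset (EuclideanSpace ℝ (Fin 3)))
    (hPAY₁ : ∀ t ∈ T₁, (walkRun X z₁ N (st₁ t)).1 ∈ PAY) (hPAY₂ : ∀ t ∈ T₂, (walkRun X z₂ N (st₂ t)).1 ∈ PAY)
    (hdisj : ∀ t ∈ T₁, ∀ t' ∈ T₂, (walkRun X z₁ N (st₁ t)).1 ≠ (walkRun X z₂ N (st₂ t')).1) :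
    (T₁.card : ℝ) + T₂.card ≤ ∑ y ∈ PAY, ((12 : ℝ) - ((X.filter fun q => dist y q = 1).card : ℝ)) := by
  set deg : EuclideanSpace ℝ (Fin 3) → ℕ := fun x => (X.filter fun q => dist x q = 1).card with hdeg
  have hdeg12 : ∀ x, deg x ≤ 12 := fun x => card_filter_dist_eq_one_le_twelve X hX x
  set f₁ : ι₁ → EuclideanSpace ℝ (Fin 3) × List WalkEntry := fun t => walkRun X z₁ N (st₁ t) with hf₁
  set f₂ : ι₂ → EuclideanSpace ℝ (Fin 3) × List WalkEntry := fun t => walkRun X z₂ N (st₂ t) with hf₂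
  -- the end data of each family
  have hend₁ : ∀ t ∈ T₁, deg (f₁ t).1 ≤ 11 ∧ WalkInv X z₁ (f₁ t) ∧ StackWF z₁ (f₁ t).2 ∧
      (f₁ t).2.getLast? = some b₁ ∧ (∃ e rest, (f₁ t).2 = e :: rest ∧ WalkCertified12 X (f₁ t).1 e) := by
    intro t ht
    obtain ⟨hI, hW, hlast, hC, hN⟩ := hst₁ t ht
    obtain ⟨-, hydeg, -, -, -, -⟩ := stackWalk_end hX hs₀ hcert hz₁ hH₁ hI hN
    have hvalid := walkRun_valid hX hs₀ hcert hz₁ N hI hW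
    exact ⟨hydeg, hvalid.1, hvalid.2, by rw [hf₁]; simp only; rw [walkRun_getLast? hX hs₀ hcert hz₁ N _ hI, hlast],
      walkRun_certified12 hX hs₀ hcert hz₁ hI hC N⟩
  have hend₂ : ∀ t ∈ T₂, deg (f₂ t).1 ≤ 11 ∧ WalkInv X z₂ (f₂ t) ∧ StackWF z₂ (f₂ t).2 ∧
      (f₂ t).2.getLast? = some b₂ ∧ (∃ e rest, (f₂ t).2 = e :: rest ∧ WalkCertified12 X (f₂ t).1 e) := by
    intro t ht
    obtain ⟨hI, hW, hlast, hC, hN⟩ := hst₂ t ht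
    obtain ⟨-, hydeg, -, -, -, -⟩ := stackWalk_end hX hs₀ hcert hz₂ hH₂ hI hN
    have hvalid := walkRun_valid hX hs₀ hcert hz₂ N hI hW
    exact ⟨hydeg, hvalid.1, hvalid.2, by rw [hf₂]; simp only; rw [walkRun_getLast? hX hs₀ hcert hz₂ N _ hI, hlast],
      walkRun_certified12 hX hs₀ hcert hz₂ hI hC N⟩
  -- dummy second bottoms for the one-sided uses of the count lemma
  obtain ⟨b₁', hb₁'⟩ := exists_walkEntry_ne b₁
  obtain ⟨b₂', hb₂'⟩ := exists_walkEntry_ne b₂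
  -- THE COUNT: per payer ball, `deg + #fibre₁ + #fibre₂ ≤ 12`
  have hpt : ∀ y ∈ PAY, deg y + (T₁.filter fun t => (f₁ t).1 = y).card + (T₂.filter fun t => (f₂ t).1 = y).card ≤ 12 := by
    intro y _
    set fib₁ := T₁.filter fun t => (f₁ t).1 = y with hfib₁
    set fib₂ := T₂.filter fun t => (f₂ t).1 = y with hfib₂
    by_cases hemp : fib₁ = ∅ ∧ fib₂ = ∅
    · rw [hemp.1, hemp.2, Finset.card_empty, Finset.card_empty]; have := hdeg12 y; omega
    -- `y` is an end ball: at most eleven contacts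
    have hdegy : deg y ≤ 11 := by
      rw [not_and_or] at hemp
      rcases hemp with hne | hne
      · obtain ⟨t, ht⟩ := Finset.nonempty_iff_ne_empty.2 hne; obtain ⟨htT, hty⟩ := Finset.mem_filter.1 ht
        have := (hend₁ t htT).1; rw [hty] at this; exact this
      · obtain ⟨t, ht⟩ := Finset.nonempty_iff_ne_empty.2 hne; obtain ⟨htT, hty⟩ := Finset.mem_filter.1 ht
        have := (hend₂ t htT).1; rw [hty] at this; exact this
    set ES₁ := fib₁.image f₁ with hES₁
    set ES₂ := fib₂.image f₂ with hES₂
    have hc₁ : ES₁.card = fib₁.card := Finset.card_image_of_injOn fun t ht t' ht' hft =>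
      hinj₁ t (Finset.mem_filter.1 ht).1 t' (Finset.mem_filter.1 ht').1 hft
    have hc₂ : ES₂.card = fib₂.card := Finset.card_image_of_injOn fun t ht t' ht' hft =>
      hinj₂ t (Finset.mem_filter.1 ht).1 t' (Finset.mem_filter.1 ht').1 hft
    have hES₁ok : ∀ s ∈ ES₁, s.1 = y ∧ WalkInv X z₁ s ∧ StackWF z₁ s.2 ∧ s.2.getLast? = some b₁ ∧
        (∃ e rest, s.2 = e :: rest ∧ WalkCertified12 X y e) ∧
        ∀ e ∈ s.2, e.frame ∈ (Set.univ : Set (EuclideanSpace ℝ (Fin 3) ≃ₗᵢ[ℝ] EuclideanSpace ℝ (Fin 3))) := by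
      intro s hs
      obtain ⟨t, ht, rfl⟩ := Finset.mem_image.1 hs; obtain ⟨htT, hty⟩ := Finset.mem_filter.1 ht
      obtain ⟨-, hI, hW, hlast, hC⟩ := hend₁ t htT; rw [hty] at hC
      exact ⟨hty, hI, hW, hlast, hC, fun e _ => Set.mem_univ e⟩
    have hES₂ok : ∀ s ∈ ES₂, s.1 = y ∧ WalkInv X z₂ s ∧ StackWF z₂ s.2 ∧ s.2.getLast? = some b₂ ∧
        (∃ e rest, s.2 = e :: rest ∧ WalkCertified12 X y e) ∧
        ∀ e ∈ s.2, e.frame ∈ (Set.univ : Set (EuclideanSpace ℝ (Fin 3) ≃ₗᵢ[ℝ] EuclideanSpace ℝ (Fin 3))) := by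
      intro s hs
      obtain ⟨t, ht, rfl⟩ := Finset.mem_image.1 hs; obtain ⟨htT, hty⟩ := Finset.mem_filter.1 ht
      obtain ⟨-, hI, hW, hlast, hC⟩ := hend₂ t htT; rw [hty] at hC
      exact ⟨hty, hI, hW, hlast, hC, fun e _ => Set.mem_univ e⟩
    -- no ball is an end ball of BOTH families
    have hone : fib₁ = ∅ ∨ fib₂ = ∅ := by
      by_contra hb
      rw [not_or] at hb
      obtain ⟨t, ht⟩ := Finset.nonempty_iff_ne_empty.2 hb.1; obtain ⟨t', ht'⟩ := Finset.nonempty_iff_ne_empty.2 hb.2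
      obtain ⟨htT, hty⟩ := Finset.mem_filter.1 ht; obtain ⟨htT', hty'⟩ := Finset.mem_filter.1 ht'
      exact hdisj t htT t' htT' (by rw [hf₁, hf₂] at *; exact hty.trans hty'.symm)
    have hsep_empty : ∀ F₁ ∈ (Set.univ : Set (EuclideanSpace ℝ (Fin 3) ≃ₗᵢ[ℝ] EuclideanSpace ℝ (Fin 3))),
        ∀ F₂ ∈ (∅ : Set (EuclideanSpace ℝ (Fin 3) ≃ₗᵢ[ℝ] EuclideanSpace ℝ (Fin 3))),
        ¬ ∃ (L : EuclideanSpace ℝ (Fin 3) ≃ₗᵢ[ℝ] EuclideanSpace ℝ (Fin 3)) (s₁ s₂ : EuclideanSpace ℝ (Fin 3)) (σ σ' : ℤ → ℤ),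
          Literature.MathematicalPhysics.StatisticalMechanics.IsHaggSeq σ ∧
          Literature.MathematicalPhysics.StatisticalMechanics.IsHaggSeq σ' ∧
          F₁ '' Literature.MathematicalPhysics.StatisticalMechanics.fccStacking 1 (Real.sqrt (2 / 3)) ⊆
            (fun p => L p + s₁) '' Literature.MathematicalPhysics.StatisticalMechanics.barlowStacking 1 (Real.sqrt (2 / 3)) σ ∧
          F₂ '' Literature.MathematicalPhysics.StatisticalMechanics.fccStacking 1 (Real.sqrt (2 / 3)) ⊆
            (fun p => L p + s₂) '' Literature.MathematicalPhysics.StatisticalMechanics.barlowStacking 1 (Real.sqrt (2 / 3)) σ' :=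
      fun F₁ _ F₂ hF₂ => absurd hF₂ (Set.notMem_empty F₂)
    rcases hone with h0 | h0
    · -- only family 2 ends here
      have hES₁e : ES₁ = ∅ := by rw [hES₁, h0, Finset.image_empty]
      have key := card_contacts_add_endStates_le_twelve_sep hX hDS hCP (Set.univ : Set _) (∅ : Set _)
        hsep_empty hb₂'.symm (z₁ := z₂) (z₂ := z₁) hdegy ES₂ (∅ : Finset _) hES₂ok
        (fun s hs => absurd hs (Finset.notMem_empty s))
      rw [Finset.card_empty, hc₂] at key
      rw [h0, Finset.card_empty]; omega
    · -- only family 1 ends here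
      have key := card_contacts_add_endStates_le_twelve_sep hX hDS hCP (Set.univ : Set _) (∅ : Set _)
        hsep_empty hb₁'.symm (z₁ := z₁) (z₂ := z₂) hdegy ES₁ (∅ : Finset _) hES₁ok
        (fun s hs => absurd hs (Finset.notMem_empty s))
      rw [Finset.card_empty, hc₁] at key
      rw [h0, Finset.card_empty]; omega
  -- summing over the payers
  have hsum₁ : T₁.card = ∑ y ∈ PAY, (T₁.filter fun t => (f₁ t).1 = y).card :=
    Finset.card_eq_sum_card_fiberwise fun t ht => hPAY₁ t ht
  have hsum₂ : T₂.card = ∑ y ∈ PAY, (T₂.filter fun t => (f₂ t).1 = y).card :=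
    Finset.card_eq_sum_card_fiberwise fun t ht => hPAY₂ t ht
  rw [hsum₁, hsum₂]; push_cast; rw [← Finset.sum_add_distrib]
  refine Finset.sum_le_sum fun y hy => ?_
  have := hpt y hy
  have h' : (deg y : ℝ) + ((T₁.filter fun t => (f₁ t).1 = y).card : ℝ) +
      ((T₂.filter fun t => (f₂ t).1 = y).card : ℝ) ≤ 12 := by exact_mod_cast this
  simp only [hdeg] at h'; linarith

open scoped Classical in
/-- **The walker-family ledger, one family.**  `#T ≤ Σ_{y ∈ PAY} (12 − deg y)` for an injective family of valid,
strongly certified, fuelled walkers whose end balls lie in `PAY`. -/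
theorem walkerFamily_card_le_payers (hX : ∀ p ∈ X, ∀ q ∈ X, p ≠ q → 1 ≤ dist p q)
    {s₀ : EuclideanSpace ℝ (Fin 3)} (hs₀ : s₀ ∈ fccSlots)
    (hcert : ExactOnly 0 (fccSlots.filter fun w => 0 < ⟪w, s₀⟫_ℝ))
    (hDS : ∀ F₁ F₂ : EuclideanSpace ℝ (Fin 3) ≃ₗᵢ[ℝ] EuclideanSpace ℝ (Fin 3), DoubleStarCoaxialAt F₁ F₂)
    (hCP : CapPairCoaxial)
    {z : EuclideanSpace ℝ (Fin 3)} (hz : ‖z‖ = 1) {H : ℝ} (hH : ∀ q ∈ X, ⟪q, z⟫_ℝ ≤ H)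
    {ι : Type*} (T : Finset ι) (st : ι → EuclideanSpace ℝ (Fin 3) × List WalkEntry) {b : WalkEntry} (N : ℕ)
    (hst : ∀ t ∈ T, WalkInv X z (st t) ∧ StackWF z (st t).2 ∧ (st t).2.getLast? = some b ∧
      (∃ e rest, (st t).2 = e :: rest ∧ WalkCertified12 X (st t).1 e) ∧ 8 * (H - ⟪(st t).1, z⟫_ℝ) < 3 * N)
    (hinj : ∀ t ∈ T, ∀ t' ∈ T, walkRun X z N (st t) = walkRun X z N (st t') → t = t')
    (PAY : Finset (EuclideanSpace ℝ (Fin 3))) (hPAY : ∀ t ∈ T, (walkRun X z N (st t)).1 ∈ PAY) :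
    (T.card : ℝ) ≤ ∑ y ∈ PAY, ((12 : ℝ) - ((X.filter fun q => dist y q = 1).card : ℝ)) := by
  have h := walkerFamilies_card_le_payers hX hs₀ hcert hDS hCP hz hz hH hH T (∅ : Finset ι) st st (b₁ := b) (b₂ := b)
    N hst (fun t ht => absurd ht (Finset.notMem_empty t)) hinj (fun t ht => absurd ht (Finset.notMem_empty t)) PAY
    hPAY (fun t ht => absurd ht (Finset.notMem_empty t)) (fun t _ t' ht' => absurd ht' (Finset.notMem_empty t'))
  rw [Finset.card_empty] at h; push_cast at h; linarith

end Summit.Ventures.Crystal3D.Theorems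

end
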